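import Summits.BirchSwinnertonDyer.BirchSwinnertonDyer.Theorems.Rank2Observatory2DescKillSig2CCore
import HarnessLib

/-!
# KERNEL-2DESC — the 2-adic signature kill at a CUBIC place, PART 2 of 3: squares and contents in the cubic tables (cert-1 g40)

The two tables: `R`: `t³ = 2` (`(m₁, m₀) = (0, 2)`, `ℤ₂[π]`, ramified) and `U`: `t³ = −t − 1` (`(m₁, m₀) = (−1, −1)`,
`ℤ₂[ζ]`, unramified); `tm₁ / tm₀` select them from `ram : Bool`.  Everything here is a congruence between integer
triples — no valuations, no `p`-adics:
* FINITE FACTS by `decide`: the residues mod `16` (R, from `S mod 8`) resp. mod `8` (U, from `S mod 4`) of all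
  squares `S²` that are `≢ 0 (mod 4)` (`sqTabR`, 168 entries; `sqTabU`, 28 entries), and the CONTENT FACT: a product
  of two triples that are not `≡ 0 (mod 2)` is not `≡ 0 (mod 4)` (R) resp. not `≡ 0 (mod 2)` (U: `𝔽₈` is a field);
* their lifts to all integer triples (`sq_tab`, `prod_content`), the STRIP LEMMA (`S² ≡ x ≡ 0 (mod 4)` forces
  `S = 2S'` with `S'² ≡ x/4` at two bits less), and the robust NON-SQUARE TEST `nonsqT ram fuel x M` — strip `4`s,
  then look the residue up — with `nonsqT_sound`: no integer triple `S` has `S² ≡ x (mod 2^M)` coordinate-wise;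
* `exists_content`: a triple not divisible by `2^(δ+1)` is `2^c · R̄` with `c ≤ δ` and `R̄ ≢ 0 (mod 2)`.
Completeness of the test (irrelevant for soundness) is the classical `1 + λ^(2e+1)𝒪 ⊂ 𝒪×²`; it is exercised by the
mirror `generics/sig2c/prod/sig2c.py` on the census.  PART 3 (`…Sig2C`) assembles the checker.

HONEST FRAMING: per-curve certified theorems and census instruments; no claim on BSD in rank ≥ 2.
[cite: CremonaAlgorithms1997, §3.6] [cite: Cassels1991LecturesEllipticCurves, §15] [cite: Cohen1993, §4.8.2]
-/

set_option linter.dupNamespace false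

namespace Summit.BirchSwinnertonDyer.BirchSwinnertonDyer.Rank2Observatory.TwoDescKill

/-! ### The two tables and coordinate-wise congruence -/

/-- `m₁` of the table: `t³ = m₁t + m₀`; `R`: `t³ = 2`, `U`: `t³ = −t − 1`. [cite: Cohen1993, §4.8.2] -/
def tm₁ (ram : Bool) : ℤ := if ram then 0 else -1

/-- `m₀` of the table. [cite: Cohen1993, §4.8.2] -/
def tm₀ (ram : Bool) : ℤ := if ram then 2 else -1

/-- Coordinate-wise congruence of triples mod `m`. [folklore] -/
def CME (m : ℤ) (A B : ℤ × ℤ × ℤ) : Prop := A.1 ≡ B.1 [ZMOD m] ∧ A.2.1 ≡ B.2.1 [ZMOD m] ∧ A.2.2 ≡ B.2.2 [ZMOD m]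

/-- `CME` is transitive. [folklore] -/
theorem CME.trans {m : ℤ} {A B C : ℤ × ℤ × ℤ} (h : CME m A B) (k : CME m B C) : CME m A C :=
  ⟨h.1.trans k.1, h.2.1.trans k.2.1, h.2.2.trans k.2.2⟩

/-- `CME` is symmetric. [folklore] -/
theorem CME.symm {m : ℤ} {A B : ℤ × ℤ × ℤ} (h : CME m A B) : CME m B A := ⟨h.1.symm, h.2.1.symm, h.2.2.symm⟩

/-- `CME` descends along divisors of the modulus. [folklore] -/
theorem CME.of_dvd {m m' : ℤ} (hd : m' ∣ m) {A B : ℤ × ℤ × ℤ} (h : CME m A B) : CME m' A B :=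
  ⟨h.1.of_dvd hd, h.2.1.of_dvd hd, h.2.2.of_dvd hd⟩

/-- `cmul` respects `CME`. [folklore] -/
theorem CME.cmul {m m₁ m₀ : ℤ} {x x' y y' : ℤ × ℤ × ℤ} (h : CME m x x') (k : CME m y y') :
    CME m (cmul m₁ m₀ x y) (cmul m₁ m₀ x' y') :=
  cmul_modEq h.1 h.2.1 h.2.2 k.1 k.2.1 k.2.2

/-- The residue triple `cmod N x` is `CME (2^N)`-congruent to `x`. [folklore] -/
theorem CME_cmod (N : ℕ) (x : ℤ × ℤ × ℤ) : CME ((2 : ℤ) ^ N) (cmod N x) x := cmod_modEq N x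

/-- `(σ + 2q'D)² = σ² + 4q'(σD + q'D²)`: squares of `mod 2q'`-congruent triples agree `mod 4q'`. [folklore] -/
theorem sq_shift (m₁ m₀ q' : ℤ) (σ D : ℤ × ℤ × ℤ) :
    cmul m₁ m₀ (cadd σ (csc (2 * q') D)) (cadd σ (csc (2 * q') D)) =
      cadd (cmul m₁ m₀ σ σ) (csc (4 * q') (cadd (cmul m₁ m₀ σ D) (csc q' (cmul m₁ m₀ D D)))) := by
  simp only [cmul, cadd, csc]; ext <;> ring

/-- If `S ≡ σ (mod 2q')` coordinate-wise then `S² ≡ σ² (mod 4q')`. [folklore] -/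
theorem CME_sq_of_CME {m₁ m₀ q' : ℤ} {S σ : ℤ × ℤ × ℤ} (h : CME (2 * q') S σ) :
    CME (4 * q') (cmul m₁ m₀ S S) (cmul m₁ m₀ σ σ) := by
  obtain ⟨d₁, hd₁⟩ := Int.modEq_iff_dvd.mp h.1.symm
  obtain ⟨d₂, hd₂⟩ := Int.modEq_iff_dvd.mp h.2.1.symm
  obtain ⟨d₃, hd₃⟩ := Int.modEq_iff_dvd.mp h.2.2.symm
  have hS : S = cadd σ (csc (2 * q') (d₁, d₂, d₃)) := by
    simp only [cadd, csc]; ext <;> simp only <;> linarith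
  rw [hS, sq_shift]
  set K := cadd (cmul m₁ m₀ σ (d₁, d₂, d₃)) (csc q' (cmul m₁ m₀ (d₁, d₂, d₃) (d₁, d₂, d₃)))
  simp only [cadd, csc]
  exact ⟨Int.modEq_iff_dvd.mpr ⟨-K.1, by ring⟩, Int.modEq_iff_dvd.mpr ⟨-K.2.1, by ring⟩,
    Int.modEq_iff_dvd.mpr ⟨-K.2.2, by ring⟩⟩

/-! ### The finite facts -/

/-- Residues mod 16 of all squares `S²` in `ℤ₂[π]` (`π³ = 2`) with `S² ≢ 0 (mod 4)` (from `S mod 8`). [folklore] -/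
def sqTabR : List (ℤ × ℤ × ℤ) := [
  (0, 0, 1), (0, 0, 9), (0, 2, 0), (0, 2, 8), (0, 6, 5), (0, 6, 13), (0, 8, 1), (0, 8, 9),
  (0, 14, 5), (0, 14, 13), (1, 0, 0), (1, 0, 4), (1, 0, 8), (1, 0, 12), (1, 2, 1), (1, 2, 2),
  (1, 2, 5), (1, 2, 6), (1, 2, 9), (1, 2, 10), (1, 2, 13), (1, 2, 14), (1, 4, 0), (1, 4, 4),
  (1, 4, 8), (1, 4, 12), (1, 6, 1), (1, 6, 2), (1, 6, 5), (1, 6, 6), (1, 6, 9), (1, 6, 10),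
  (1, 6, 13), (1, 6, 14), (1, 8, 0), (1, 8, 4), (1, 8, 8), (1, 8, 12), (1, 10, 1), (1, 10, 2),
  (1, 10, 5), (1, 10, 6), (1, 10, 9), (1, 10, 10), (1, 10, 13), (1, 10, 14), (1, 12, 0), (1, 12, 4),
  (1, 12, 8), (1, 12, 12), (1, 14, 1), (1, 14, 2), (1, 14, 5), (1, 14, 6), (1, 14, 9), (1, 14, 10),
  (1, 14, 13), (1, 14, 14), (4, 2, 1), (4, 2, 4), (4, 2, 9), (4, 2, 12), (4, 4, 1), (4, 4, 9),
  (4, 10, 1), (4, 10, 9), (4, 12, 1), (4, 12, 9), (5, 0, 3), (5, 0, 7), (5, 0, 11), (5, 0, 15),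
  (5, 4, 3), (5, 4, 7), (5, 4, 11), (5, 4, 15), (5, 8, 3), (5, 8, 7), (5, 8, 11), (5, 8, 15),
  (5, 12, 3), (5, 12, 7), (5, 12, 11), (5, 12, 15), (8, 0, 1), (8, 0, 9), (8, 2, 4), (8, 2, 12),
  (8, 6, 5), (8, 6, 13), (8, 8, 1), (8, 8, 9), (8, 14, 5), (8, 14, 13), (9, 0, 0), (9, 0, 4),
  (9, 0, 8), (9, 0, 12), (9, 2, 1), (9, 2, 2), (9, 2, 5), (9, 2, 6), (9, 2, 9), (9, 2, 10),
  (9, 2, 13), (9, 2, 14), (9, 4, 0), (9, 4, 4), (9, 4, 8), (9, 4, 12), (9, 6, 1), (9, 6, 2),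
  (9, 6, 5), (9, 6, 6), (9, 6, 9), (9, 6, 10), (9, 6, 13), (9, 6, 14), (9, 8, 0), (9, 8, 4),
  (9, 8, 8), (9, 8, 12), (9, 10, 1), (9, 10, 2), (9, 10, 5), (9, 10, 6), (9, 10, 9), (9, 10, 10),
  (9, 10, 13), (9, 10, 14), (9, 12, 0), (9, 12, 4), (9, 12, 8), (9, 12, 12), (9, 14, 1), (9, 14, 2),
  (9, 14, 5), (9, 14, 6), (9, 14, 9), (9, 14, 10), (9, 14, 13), (9, 14, 14), (12, 2, 1), (12, 2, 9),
  (12, 4, 1), (12, 4, 9), (12, 10, 0), (12, 10, 1), (12, 10, 8), (12, 10, 9), (12, 12, 1), (12, 12, 9),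
  (13, 0, 3), (13, 0, 7), (13, 0, 11), (13, 0, 15), (13, 4, 3), (13, 4, 7), (13, 4, 11), (13, 4, 15),
  (13, 8, 3), (13, 8, 7), (13, 8, 11), (13, 8, 15), (13, 12, 3), (13, 12, 7), (13, 12, 11), (13, 12, 15)]

/-- Residues mod 8 of all squares `S²` in `ℤ₂[ζ]` (`ζ³ = −ζ − 1`) with `S² ≢ 0 (mod 4)` (from `S mod 4`). [folklore] -/
def sqTabU : List (ℤ × ℤ × ℤ) := [
  (0, 0, 1), (0, 3, 7), (0, 4, 5), (0, 7, 7), (1, 0, 0), (1, 0, 4), (1, 2, 1), (1, 4, 0),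
  (1, 4, 4), (1, 6, 1), (1, 7, 1), (1, 7, 5), (2, 1, 0), (2, 1, 4), (3, 3, 6), (3, 7, 2),
  (4, 0, 5), (4, 3, 3), (4, 4, 1), (4, 7, 3), (5, 2, 1), (5, 6, 1), (5, 7, 1), (5, 7, 5),
  (6, 5, 0), (6, 5, 4), (7, 3, 6), (7, 7, 2)]

/-- `x ≡ 0 (mod 4)` coordinate-wise, as a `Bool`. [folklore] -/
def czero4 (x : ℤ × ℤ × ℤ) : Bool := x.1 % 4 == 0 && x.2.1 % 4 == 0 && x.2.2 % 4 == 0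

/-- `x ≡ 0 (mod 2)` coordinate-wise, as a `Bool`. [folklore] -/
def czero2 (x : ℤ × ℤ × ℤ) : Bool := x.1 % 2 == 0 && x.2.1 % 2 == 0 && x.2.2 % 2 == 0

/-- The table condition: `x ≡ 0 (mod 4)` or the residue of `x` (mod 16 for R, mod 8 for U) is tabulated. [folklore] -/
def tabCond (ram : Bool) (x : ℤ × ℤ × ℤ) : Bool :=
  czero4 x || (if ram then sqTabR.elem (cmod 4 x) else sqTabU.elem (cmod 3 x))

/-- FINITE FACT (R): every square satisfies the table condition (checked on `S mod 8`). [folklore] -/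
theorem tabCond_finR : ∀ a b c : Fin 8,
    tabCond true (cmul 0 2 (((a : ℕ) : ℤ), ((b : ℕ) : ℤ), ((c : ℕ) : ℤ)) (((a : ℕ) : ℤ), ((b : ℕ) : ℤ), ((c : ℕ) : ℤ))) = true := by
  decide

/-- FINITE FACT (U): every square satisfies the table condition (checked on `S mod 4`). [folklore] -/
theorem tabCond_finU : ∀ a b c : Fin 4,
    tabCond false (cmul (-1) (-1) (((a : ℕ) : ℤ), ((b : ℕ) : ℤ), ((c : ℕ) : ℤ)) (((a : ℕ) : ℤ), ((b : ℕ) : ℤ), ((c : ℕ) : ℤ))) = true := by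
  decide

/-- FINITE FACT (R): the product of two triples `≢ 0 (mod 2)` is `≢ 0 (mod 4)` (checked on residues mod 4). [folklore] -/
theorem content_finR : ∀ a b c a' b' c' : Fin 4,
    czero2 (((a : ℕ) : ℤ), ((b : ℕ) : ℤ), ((c : ℕ) : ℤ)) = false → czero2 (((a' : ℕ) : ℤ), ((b' : ℕ) : ℤ), ((c' : ℕ) : ℤ)) = false →
    czero4 (cmul 0 2 (((a : ℕ) : ℤ), ((b : ℕ) : ℤ), ((c : ℕ) : ℤ)) (((a' : ℕ) : ℤ), ((b' : ℕ) : ℤ), ((c' : ℕ) : ℤ))) = false := by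
  decide

/-- FINITE FACT (U): the product of two triples `≢ 0 (mod 2)` is `≢ 0 (mod 2)` — `𝔽₈` is a field. [folklore] -/
theorem content_finU : ∀ a b c a' b' c' : Fin 2,
    czero2 (((a : ℕ) : ℤ), ((b : ℕ) : ℤ), ((c : ℕ) : ℤ)) = false → czero2 (((a' : ℕ) : ℤ), ((b' : ℕ) : ℤ), ((c' : ℕ) : ℤ)) = false →
    czero2 (cmul (-1) (-1) (((a : ℕ) : ℤ), ((b : ℕ) : ℤ), ((c : ℕ) : ℤ)) (((a' : ℕ) : ℤ), ((b' : ℕ) : ℤ), ((c' : ℕ) : ℤ))) = false := by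
  decide

/-! ### Lifting residues -/

/-- The residue of `x` mod `q > 0` as a `Fin q` with the right cast. [folklore] -/
theorem exists_fin_res (q : ℕ) (hq : 0 < q) (x : ℤ) : ∃ a : Fin q, ((a : ℕ) : ℤ) ≡ x [ZMOD (q : ℤ)] := by
  refine ⟨⟨(x % (q : ℤ)).toNat, ?_⟩, ?_⟩
  · have h₁ := Int.emod_nonneg x (by exact_mod_cast hq.ne' : (q : ℤ) ≠ 0)
    have h₂ := Int.emod_lt_of_pos x (by exact_mod_cast hq : (0 : ℤ) < q)
    omega
  · have h₁ := Int.emod_nonneg x (by exact_mod_cast hq.ne' : (q : ℤ) ≠ 0)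
    simp only [Int.toNat_of_nonneg h₁]
    exact Int.mod_modEq x q

/-- `czero2` only depends on the triple mod 2. [folklore] -/
theorem czero2_congr {m : ℤ} (hm : (2 : ℤ) ∣ m) {x x' : ℤ × ℤ × ℤ} (h : CME m x x') : czero2 x = czero2 x' := by
  obtain ⟨h₁, h₂, h₃⟩ := h.of_dvd hm
  unfold czero2
  rw [h₁, h₂, h₃]

/-- `czero4` only depends on the triple mod 4. [folklore] -/
theorem czero4_congr {m : ℤ} (hm : (4 : ℤ) ∣ m) {x x' : ℤ × ℤ × ℤ} (h : CME m x x') : czero4 x = czero4 x' := by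
  obtain ⟨h₁, h₂, h₃⟩ := h.of_dvd hm
  unfold czero4
  rw [h₁, h₂, h₃]

/-- `cmod N` only depends on the triple mod `2^N`. [folklore] -/
theorem cmod_congr {N : ℕ} {m : ℤ} (hm : (2 : ℤ) ^ N ∣ m) {x x' : ℤ × ℤ × ℤ} (h : CME m x x') :
    cmod N x = cmod N x' := by
  obtain ⟨h₁, h₂, h₃⟩ := h.of_dvd hm
  unfold cmod
  rw [h₁, h₂, h₃]

/-- `tabCond` only depends on the triple mod 16 (R) / mod 8 (U). [folklore] -/
theorem tabCond_congr (ram : Bool) {m : ℤ} (hm : (if ram then (16 : ℤ) else 8) ∣ m) {x x' : ℤ × ℤ × ℤ}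
    (h : CME m x x') : tabCond ram x = tabCond ram x' := by
  cases ram
  · simp only [Bool.false_eq_true, ↓reduceIte] at hm
    unfold tabCond
    simp only [Bool.false_eq_true, ↓reduceIte]
    rw [czero4_congr (dvd_trans (by norm_num) hm) h, cmod_congr (N := 3) (dvd_trans (by norm_num) hm) h]
  · simp only [↓reduceIte] at hm
    unfold tabCond
    simp only [↓reduceIte]
    rw [czero4_congr (dvd_trans (by norm_num) hm) h, cmod_congr (N := 4) (dvd_trans (by norm_num) hm) h]

/-- **Every square satisfies the table condition** (both tables). [folklore] -/
theorem tabCond_sq (ram : Bool) (S : ℤ × ℤ × ℤ) : tabCond ram (cmul (tm₁ ram) (tm₀ ram) S S) = true := by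
  cases ram
  · -- U: residues mod 4, squares agree mod 8; `tabCond false` reads mod 8 (and mod 4)
    obtain ⟨a, ha⟩ := exists_fin_res 4 (by norm_num) S.1
    obtain ⟨b, hb⟩ := exists_fin_res 4 (by norm_num) S.2.1
    obtain ⟨c, hc⟩ := exists_fin_res 4 (by norm_num) S.2.2
    have hσ : CME (2 * 2) S (((a : ℕ) : ℤ), ((b : ℕ) : ℤ), ((c : ℕ) : ℤ)) := ⟨ha.symm, hb.symm, hc.symm⟩
    have hsq := CME_sq_of_CME (m₁ := -1) (m₀ := -1) hσ
    have := tabCond_finU a b c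
    simp only [tm₁, tm₀, Bool.false_eq_true, ↓reduceIte]
    rw [tabCond_congr false (by norm_num) hsq]
    exact this
  · obtain ⟨a, ha⟩ := exists_fin_res 8 (by norm_num) S.1
    obtain ⟨b, hb⟩ := exists_fin_res 8 (by norm_num) S.2.1
    obtain ⟨c, hc⟩ := exists_fin_res 8 (by norm_num) S.2.2
    have hσ : CME (2 * 4) S (((a : ℕ) : ℤ), ((b : ℕ) : ℤ), ((c : ℕ) : ℤ)) := ⟨ha.symm, hb.symm, hc.symm⟩
    have hsq := CME_sq_of_CME (m₁ := 0) (m₀ := 2) hσ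
    have := tabCond_finR a b c
    simp only [tm₁, tm₀, ↓reduceIte]
    rw [tabCond_congr true (by norm_num) hsq]
    exact this

/-- **Content of a product**: if neither `Y` nor `Y'` is `≡ 0 (mod 2)` then `Y·Y'` is not `≡ 0 (mod 4)` (R)
resp. not `≡ 0 (mod 2)` (U). [folklore] -/
theorem prod_content (ram : Bool) {Y Y' : ℤ × ℤ × ℤ} (hY : czero2 Y = false) (hY' : czero2 Y' = false) :
    (if ram then czero4 (cmul (tm₁ ram) (tm₀ ram) Y Y') else czero2 (cmul (tm₁ ram) (tm₀ ram) Y Y')) = false := by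
  cases ram
  · obtain ⟨a, ha⟩ := exists_fin_res 2 (by norm_num) Y.1
    obtain ⟨b, hb⟩ := exists_fin_res 2 (by norm_num) Y.2.1
    obtain ⟨c, hc⟩ := exists_fin_res 2 (by norm_num) Y.2.2
    obtain ⟨a', ha'⟩ := exists_fin_res 2 (by norm_num) Y'.1
    obtain ⟨b', hb'⟩ := exists_fin_res 2 (by norm_num) Y'.2.1
    obtain ⟨c', hc'⟩ := exists_fin_res 2 (by norm_num) Y'.2.2
    have hσ : CME 2 Y (((a : ℕ) : ℤ), ((b : ℕ) : ℤ), ((c : ℕ) : ℤ)) := ⟨ha.symm, hb.symm, hc.symm⟩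
    have hσ' : CME 2 Y' (((a' : ℕ) : ℤ), ((b' : ℕ) : ℤ), ((c' : ℕ) : ℤ)) := ⟨ha'.symm, hb'.symm, hc'.symm⟩
    have := content_finU a b c a' b' c' (by rwa [← czero2_congr (dvd_refl 2) hσ])
      (by rwa [← czero2_congr (dvd_refl 2) hσ'])
    simp only [tm₁, tm₀, Bool.false_eq_true, ↓reduceIte]
    rwa [czero2_congr (dvd_refl 2) (hσ.cmul hσ')]
  · obtain ⟨a, ha⟩ := exists_fin_res 4 (by norm_num) Y.1
    obtain ⟨b, hb⟩ := exists_fin_res 4 (by norm_num) Y.2.1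
    obtain ⟨c, hc⟩ := exists_fin_res 4 (by norm_num) Y.2.2
    obtain ⟨a', ha'⟩ := exists_fin_res 4 (by norm_num) Y'.1
    obtain ⟨b', hb'⟩ := exists_fin_res 4 (by norm_num) Y'.2.1
    obtain ⟨c', hc'⟩ := exists_fin_res 4 (by norm_num) Y'.2.2
    have hσ : CME 4 Y (((a : ℕ) : ℤ), ((b : ℕ) : ℤ), ((c : ℕ) : ℤ)) := ⟨ha.symm, hb.symm, hc.symm⟩
    have hσ' : CME 4 Y' (((a' : ℕ) : ℤ), ((b' : ℕ) : ℤ), ((c' : ℕ) : ℤ)) := ⟨ha'.symm, hb'.symm, hc'.symm⟩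
    have := content_finR a b c a' b' c' (by rwa [← czero2_congr (by norm_num) hσ])
      (by rwa [← czero2_congr (by norm_num) hσ'])
    simp only [tm₁, tm₀, ↓reduceIte]
    rwa [czero4_congr (dvd_refl 4) (hσ.cmul hσ')]

/-! ### Stripping and the non-square test -/

/-- `(kA)(kB) = k²(AB)`. [folklore] -/
theorem cmul_csc_csc (m₁ m₀ k : ℤ) (A B : ℤ × ℤ × ℤ) :
    cmul m₁ m₀ (csc k A) (csc k B) = csc (k * k) (cmul m₁ m₀ A B) := by
  simp only [cmul, csc]; ext <;> ring

/-- **Strip lemma.** A square `≡ 0 (mod 4)` coordinate-wise is the square of an even triple: `S = 2S'`. [folklore] -/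
theorem even_of_sq_zero4 (ram : Bool) {S : ℤ × ℤ × ℤ} (h : czero4 (cmul (tm₁ ram) (tm₀ ram) S S) = true) :
    ∃ S' : ℤ × ℤ × ℤ, S = csc 2 S' := by
  by_cases hS : czero2 S = true
  · simp only [czero2, Bool.and_eq_true, beq_iff_eq] at hS
    obtain ⟨⟨hS₁, hS₂⟩, hS₃⟩ := hS
    obtain ⟨⟨d₁, hd₁⟩, ⟨d₂, hd₂⟩, ⟨d₃, hd₃⟩⟩ : (2 : ℤ) ∣ S.1 ∧ (2 : ℤ) ∣ S.2.1 ∧ (2 : ℤ) ∣ S.2.2 :=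
      ⟨Int.dvd_of_emod_eq_zero hS₁, Int.dvd_of_emod_eq_zero hS₂, Int.dvd_of_emod_eq_zero hS₃⟩
    exact ⟨(d₁, d₂, d₃), by simp only [csc]; ext <;> simp only <;> assumption⟩
  · have hc := prod_content ram (Y := S) (Y' := S) (by simpa using hS) (by simpa using hS)
    cases ram
    · simp only [Bool.false_eq_true, ↓reduceIte] at hc
      -- U: `S² ≢ 0 (mod 2)` contradicts `S² ≡ 0 (mod 4)`
      simp only [czero4, Bool.and_eq_true, beq_iff_eq] at h
      simp only [czero2, Bool.and_eq_false_iff, beq_eq_false_iff_ne, ne_eq] at hc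
      omega
    · simp only [↓reduceIte] at hc
      rw [hc] at h; exact absurd h Bool.false_ne_true

/-- The robust non-square test: strip `4`s (two bits of precision each), then table lookup at `M ≥ 4` (R) / `M ≥ 3`
(U) bits: returns `true` only if NO integer triple `S` has `S² ≡ x (mod 2^M)` coordinate-wise. [folklore] -/
def nonsqT (ram : Bool) : ℕ → ℤ × ℤ × ℤ → ℕ → Bool
  | 0, _, _ => false
  | f + 1, x, M =>
      if czero4 x then decide (2 ≤ M) && nonsqT ram f (x.1 / 4, x.2.1 / 4, x.2.2 / 4) (M - 2)
      else decide ((if ram then 4 else 3) ≤ M) && !(tabCond ram x)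

/-- **Soundness of the non-square test.** [folklore] -/
theorem nonsqT_sound (ram : Bool) : ∀ (f : ℕ) (x : ℤ × ℤ × ℤ) (M : ℕ), nonsqT ram f x M = true →
    ∀ S : ℤ × ℤ × ℤ, CME ((2 : ℤ) ^ M) (cmul (tm₁ ram) (tm₀ ram) S S) x → False
  | 0, x, M, h, S, hS => by simp [nonsqT] at h
  | f + 1, x, M, h, S, hS => by
      rw [nonsqT] at h
      by_cases hz : czero4 x = true
      · rw [if_pos hz] at h
        simp only [Bool.and_eq_true, decide_eq_true_eq] at h
        obtain ⟨hM, hrec⟩ := h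
        have h4 : (4 : ℤ) ∣ (2 : ℤ) ^ M := by
          rw [show (4 : ℤ) = 2 ^ 2 by norm_num]; exact pow_dvd_pow 2 hM
        -- `S² ≡ x ≡ 0 (mod 4)` ⇒ `S = 2S'`
        have hsq4 : czero4 (cmul (tm₁ ram) (tm₀ ram) S S) = true := by rwa [czero4_congr h4 hS]
        obtain ⟨S', rfl⟩ := even_of_sq_zero4 ram hsq4
        rw [cmul_csc_csc] at hS
        simp only [czero4, Bool.and_eq_true, beq_iff_eq] at hz
        obtain ⟨⟨e₁, e₂⟩, e₃⟩ := hz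
        have hpow : (2 : ℤ) ^ M = 2 ^ (M - 2) * 4 := by
          rw [show (4 : ℤ) = 2 ^ 2 by norm_num, ← pow_add, Nat.sub_add_cancel hM]
        refine nonsqT_sound ram f _ (M - 2) hrec S' ⟨?_, ?_, ?_⟩
        · have := (Int.modEq_iff_dvd.mp hS.1.symm); simp only [csc] at this
          refine Int.modEq_iff_dvd.mpr ?_
          rw [hpow] at this
          have hx : x.1 = 4 * (x.1 / 4) := by omega
          rw [hx, show (2:ℤ) * 2 * (cmul (tm₁ ram) (tm₀ ram) S' S').1 - 4 * (x.1 / 4) =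
            4 * ((cmul (tm₁ ram) (tm₀ ram) S' S').1 - x.1 / 4) by ring, mul_comm] at this
          have := (mul_dvd_mul_iff_left (by norm_num : (4 : ℤ) ≠ 0)).mp this
          simpa [dvd_sub_comm] using this
        · have := (Int.modEq_iff_dvd.mp hS.2.1.symm); simp only [csc] at this
          refine Int.modEq_iff_dvd.mpr ?_
          rw [hpow] at this
          have hx : x.2.1 = 4 * (x.2.1 / 4) := by omega
          rw [hx, show (2:ℤ) * 2 * (cmul (tm₁ ram) (tm₀ ram) S' S').2.1 - 4 * (x.2.1 / 4) =
            4 * ((cmul (tm₁ ram) (tm₀ ram) S' S').2.1 - x.2.1 / 4) by ring, mul_comm] at this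
          have := (mul_dvd_mul_iff_left (by norm_num : (4 : ℤ) ≠ 0)).mp this
          simpa [dvd_sub_comm] using this
        · have := (Int.modEq_iff_dvd.mp hS.2.2.symm); simp only [csc] at this
          refine Int.modEq_iff_dvd.mpr ?_
          rw [hpow] at this
          have hx : x.2.2 = 4 * (x.2.2 / 4) := by omega
          rw [hx, show (2:ℤ) * 2 * (cmul (tm₁ ram) (tm₀ ram) S' S').2.2 - 4 * (x.2.2 / 4) =
            4 * ((cmul (tm₁ ram) (tm₀ ram) S' S').2.2 - x.2.2 / 4) by ring, mul_comm] at this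
          have := (mul_dvd_mul_iff_left (by norm_num : (4 : ℤ) ≠ 0)).mp this
          simpa [dvd_sub_comm] using this
      · rw [if_neg hz] at h
        simp only [Bool.and_eq_true, decide_eq_true_eq, Bool.not_eq_true'] at h
        obtain ⟨hM, htab⟩ := h
        have hq : (if ram then (16 : ℤ) else 8) ∣ (2 : ℤ) ^ M := by
          cases ram
          · simp only [Bool.false_eq_true, ↓reduceIte] at hM ⊢
            rw [show (8 : ℤ) = 2 ^ 3 by norm_num]; exact pow_dvd_pow 2 hM
          · simp only [↓reduceIte] at hM ⊢
            rw [show (16 : ℤ) = 2 ^ 4 by norm_num]; exact pow_dvd_pow 2 hM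
        have := tabCond_sq ram S
        rw [tabCond_congr ram hq hS, htab] at this
        exact Bool.false_ne_true this

end Summit.BirchSwinnertonDyer.BirchSwinnertonDyer.Rank2Observatory.TwoDescKill
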